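import Summits.ResolutionOfSingularities.ResolutionOfSingularities.Theorems.PAlterationPicoverKernelHonesty
import Mathlib.AlgebraicGeometry.SpreadingOut
import HarnessLib

/-!
# Crux `Picover` (stmt-ResolutionOfSingularities-0554), line `degree-p-tower`:
# Temkin 2008, Prop. 2.3.4, the converse (ii)⇒(iii) over a locally Noetherian base

Route `ResolutionOfSingularities/pAlteration`, crux `Picover`, line `degree-p-tower`. Support
file (`--supports stmt-ResolutionOfSingularities-0554`), registered helper
`localBlowupsAdmitDesingularization_of_resolutionOver`.

`PAlterationPicoverKernelHonesty.lean` proves the easy converse of Temkin's localisation of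
desingularization for INTEGRAL schemes of finite type over a FIELD
(`KernelHonesty.admitsDesingularization_of_isBlowup_stalk_of_resolutionOver`). This file records it
in Temkin's own generality (Prop. 2.3.4, variant (1), `d = ∞`): for every locally Noetherian base
scheme `k`, resolution of singularities over `k` (`ResolutionOver k`: every integral `k`-scheme of
finite type admits a desingularization) implies condition (iii)
(`LocalBlowupsAdmitDesingularization k`: for `X → k` of finite type and `x ∈ X` with `𝒪_{X,x}` a
domain, every blow-up of `Spec 𝒪_{X,x}` singular only over the closed point admits a
desingularization). Together with the vendored named fact `Temkin2008_prop234` ((iii)⇒(ii), which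
needs quasi-excellence) this makes Prop. 2.3.4 (1) an equivalence in the tree.

Proof. `X` is locally Noetherian (`LocallyOfFiniteType.isLocallyNoetherian`). Since `𝒪_{X,x}` is
a domain, `x` has an open neighbourhood `U ⊆ X` which is an integral scheme
(`exists_mem_and_isIntegral_of_isDomain_stalk`: on a locally Noetherian scheme some affine
`U ∋ x` has `Γ(X, U) → 𝒪_{X,x}` injective, `Scheme.IsGermInjective`, so `Γ(X, U)` is a domain).
`U ↪ X` is quasi-compact (`X` locally Noetherian), so `U` is an integral `k`-scheme of finite
type, and every blow-up of `U` is empty (zero centre) or again an integral `k`-scheme of finite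
type (blow-ups are proper), hence admits a desingularization by `ResolutionOver k`. Now
`KernelHonesty.admitsDesingularization_of_isBlowup_stalk` (Temkin's (ii)⇒(iii) per scheme) applies
to `U` at `x`, and `Spec 𝒪_{U,x} ≅ Spec 𝒪_{X,x}`; blow-ups transport along this isomorphism
(`IsBlowup.comp_iso`). The hypothesis "`S'` singular only over the closed point" is not used.

No new definitions; no statement item is restated. [cite: Temkin2008, Prop. 2.3.4, Def. 2.3.1]
-/

noncomputable section

open CategoryTheory CategoryTheory.Limits AlgebraicGeometry TopologicalSpace IsLocalRing
open Literature.AlgebraicGeometry.Resolution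

set_option linter.dupNamespace false -- mandated namespace of this single-conjunct summit

namespace Summit.ResolutionOfSingularities.ResolutionOfSingularities.Theorems.Picover.KernelHonestyGeneral

universe u

/-! ## An integral open neighbourhood of a point with integral local ring -/

/-- **On a locally Noetherian scheme, a point whose local ring is a domain has an open
neighbourhood which is an integral scheme.** Proof: locally Noetherian schemes are
germ-injective (`Scheme.IsGermInjective`), i.e. some affine open `U ∋ x` has
`Γ(X, U) → 𝒪_{X,x}` injective; then `Γ(X, U)` is a domain and the affine scheme `U` is integral.
(Cf. Görtz–Wedhorn, Exercise 3.16, for the irreducibility half.) [folklore] -/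
theorem exists_mem_and_isIntegral_of_isDomain_stalk (X : Scheme.{u}) [IsLocallyNoetherian X]
    (x : X) [IsDomain (X.presheaf.stalk x)] :
    ∃ U : X.Opens, x ∈ U ∧ IsIntegral (U : Scheme.{u}) := by
  obtain ⟨U, hxU, hU, hinj⟩ := X.exists_germ_injective x
  haveI : IsDomain Γ(X, U) := Function.Injective.isDomain _ hinj
  haveI : IsAffine (U : Scheme.{u}) := hU
  haveI : Nonempty (U : Scheme.{u}) := ⟨⟨x, hxU⟩⟩
  haveI : IsDomain Γ(U, ⊤) :=
    MulEquiv.isDomain Γ(X, U) U.topIso.commRingCatIsoToRingEquiv.toMulEquiv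
  exact ⟨U, hxU, isIntegral_of_isAffine_of_isDomain U⟩

/-! ## Blow-ups of an integral open of finite type admit desingularizations -/

/-- **Every blow-up of an integral open subscheme of a `k`-scheme of finite type admits a
desingularization, granted resolution of singularities over the locally Noetherian base `k`.**
For `f : X → k` locally of finite type and quasi-compact and `U ⊆ X` an integral open: `U ↪ X` is
quasi-compact (`X` is locally Noetherian), so `U` is an integral `k`-scheme of finite type; a
blow-up of `U` along the zero ideal is empty, along a nonzero ideal it is integral and proper over
`U`, hence an integral `k`-scheme of finite type. [cite: Temkin2008, Def. 2.3.1] -/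
theorem admitsDesingularization_of_isBlowup_opens {k X : Scheme.{u}} [IsLocallyNoetherian k]
    (hres : ResolutionOver k) (f : X ⟶ k) [LocallyOfFiniteType f] [QuasiCompact f]
    (U : X.Opens) [IsIntegral (U : Scheme.{u})] (X₁ : Scheme.{u}) (b : X₁ ⟶ (U : Scheme.{u}))
    (J : (U : Scheme.{u}).IdealSheafData) (hb : IsBlowup b J) :
    Scheme.AdmitsDesingularization X₁ := by
  haveI : IsLocallyNoetherian X := LocallyOfFiniteType.isLocallyNoetherian f
  by_cases hJ : J = ⊥
  · subst hJ
    haveI := hb.isEmpty_of_bot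
    exact Scheme.admitsDesingularization_of_isEmpty X₁
  haveI : IsIntegral X₁ := hb.isIntegral hJ
  haveI : IsProper b := hb.isProper
  haveI : LocallyOfFiniteType (b ≫ U.ι ≫ f) := inferInstance
  haveI : QuasiCompact (b ≫ U.ι ≫ f) := inferInstance
  exact hres X₁ (b ≫ U.ι ≫ f)

/-! ## Temkin 2008, Prop. 2.3.4 (1), (ii)⇒(iii), over a locally Noetherian base -/

/-- **Temkin 2008, Prop. 2.3.4 (variant (1), `d = ∞`), the converse (ii)⇒(iii) over any locally
Noetherian base scheme `k`: resolution of singularities over `k` implies that the blow-ups of the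
integral local `k`-schemes essentially of finite type admit desingularizations.** Given
`f : X → k` of finite type, `x ∈ X` with `𝒪_{X,x}` a domain and a blow-up
`g : S' → Spec 𝒪_{X,x}`: shrink `X` to an integral open neighbourhood `U` of `x`
(`exists_mem_and_isIntegral_of_isDomain_stalk`); all blow-ups of `U` admit desingularizations
(`admitsDesingularization_of_isBlowup_opens`), so Temkin's per-scheme converse
`KernelHonesty.admitsDesingularization_of_isBlowup_stalk` desingularizes every blow-up of
`Spec 𝒪_{U,x} ≅ Spec 𝒪_{X,x}`, and blow-ups transport along this isomorphism
(`IsBlowup.comp_iso`). The hypothesis "`S'` is singular only over the closed point" is idle.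
[cite: Temkin2008, Prop. 2.3.4, Def. 2.3.1] -/
theorem localBlowupsAdmitDesingularization_of_resolutionOver : ∀ (k : Scheme.{u}) [IsLocallyNoetherian k], ResolutionOver k → LocalBlowupsAdmitDesingularization k := by
  intro k _ hres X f _ _ x hdom S' g I hg _
  haveI : IsLocallyNoetherian X := LocallyOfFiniteType.isLocallyNoetherian f
  obtain ⟨U, hxU, hUint⟩ := exists_mem_and_isIntegral_of_isDomain_stalk X x
  -- `Spec 𝒪_{X,x} ≅ Spec 𝒪_{U,x}`
  let e : Spec (X.presheaf.stalk x) ≅ Spec ((U : Scheme.{u}).presheaf.stalk ⟨x, hxU⟩) :=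
    asIso (Spec.map (U.stalkIso ⟨x, hxU⟩).hom)
  have hg' : IsBlowup (g ≫ e.hom) (I.comap e.inv) := hg.comp_iso e
  exact KernelHonesty.admitsDesingularization_of_isBlowup_stalk
    (admitsDesingularization_of_isBlowup_opens hres f U) (⟨x, hxU⟩ : U) hg'

end Summit.ResolutionOfSingularities.ResolutionOfSingularities.Theorems.Picover.KernelHonestyGeneral

end
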